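/-
Copyright (c) 2026 the pub-hodgecm-mathlib formalisation cell (harness21).  Prover seat hodgecm-mathlib-A-p19 (g24) — (U) road, brick U1′ (local non-degeneracy), 2026-09-01.
-/
import Literature.NumberTheory.Weil1964.UnitaryArchLocalTopFormHaarCM      -- ★ U1 FILE B∕C (A-p06 g28): `skewC`, `traceFormC`, `lieGramC`, `lieFinBasisC`, `lieGramDetC`, `localTopFormHaar`, `archLocalTopFormHaar`
import Literature.NumberTheory.Automorphic.ArchLocalWallCentralizerHaar     -- ★ `isHermitian_and_det_ne_zero_diagonal_map_embedding`
import Literature.NumberTheory.Automorphic.ArchLocalRegularTorusClasses     -- ★ `UnitaryGroup.im_embedding_eq_zero_of_complexConj_eq`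
import HarnessLib

/-!
# The trace form on the one-place real form `𝔲(Jw) ⊂ M_N(ℂ)` is non-degenerate for `Jw` hermitian invertible — the hypothesis `hnd` of ★ `localTopFormHaar` discharged;
# hence `archLocalTopFormHaar L n (diagonal b) w` IS a Haar measure at every real non-degenerate diagonal block ((U) road, brick U1′; Rogawski 1990 §1.7; Knapp 2002 I §1)

Topic `NumberTheory/Weil1964`; namespace `Literature.NumberTheory.Weil1964.UnitaryArchLocalTopForm` (the home of ★ U1 FILE B∕C).  THEOREMS ONLY (no `def`, no instance, no
notation, no axiom, no named fact, no `sorry`).  Cell `pub/hodgecm-mathlib`, crux H413 = `stmt-HodgeConjecture-24833` (supports only); the (U) road (owner A-p19 (g24), card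
`ROAD-U-v1` 516073b6; LEAD F0P3a-plan (g10) T9-36∕T9-37 (3)).  This is the ONE-PLACE TWIN of ★ B1′ `UnitaryArchTopFormHaarCM` §2–§3 (`skewAdjoint_mem_archSkew`,
`traceForm_skewAdjoint_pos`, `traceForm_nondegenerate`, `lieGramDet_ne_zero`), whose proof was already written place by place; it is independent of the GLOBAL field and of the
splitting `𝔲 ≃ Π_w 𝔲_w` (A-p12 (g20)'s (E3) `lieGramDetC_ne_zero_of_lieGramDet_ne_zero` derives the same conclusion through the splitting for RATIONAL `J`; both are welcome —
this one needs only `Jwᴴ = Jw`, `det Jw ≠ 0`).  Count-neutral.  HONEST LABEL: HC_CM is proved only modulo the 2 remaining named inputs (hLiu418 24832, h413 24833) until rung 0 closes.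

THE ARGUMENT (Knapp I §1: the classical real forms are reductive, the trace form restricted to them is non-degenerate).  For `X ∈ 𝔲(Jw)` (`Xᴴ Jw + Jw X = 0`) put
`Y := Xᴴ − Jw⁻¹ X Jw`.  Then `Y ∈ 𝔲(Jw)` and `Re tr(X Y) = Re tr(X Xᴴ) − Re tr(X Jw⁻¹ X Jw) = 2 ∑_{ij} |X_{ij}|²` (cyclicity and `Jw X Jw⁻¹ = −Xᴴ`), which is `> 0` for `X ≠ 0`.
So the trace form is non-degenerate on `𝔲(Jw)`, the Gram matrix of any basis is invertible, `lieGramDetC N Jw ≠ 0`, and ★ `isHaarMeasure_localTopFormHaar` applies.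
* §1 `skewAdjointC_mem_skewC`, `traceFormC_comm`, `traceFormC_skewAdjointC_eq`, `traceFormC_skewAdjointC_pos`, **`traceFormC_nondegenerate`**, **`lieGramDetC_ne_zero_of_conjTranspose_eq`**,
  `isHaarMeasure_localTopFormHaar_of_conjTranspose_eq`.
* §2 (CM readings, the shapes the (U) road's U4∕U5 consume) **`isHaarMeasure_archLocalTopFormHaar_of_isHermitian`**, **`isHaarMeasure_archLocalTopFormHaar_diagonal`**
  (`b : Fin n → L` real non-zero ⇒ `archLocalTopFormHaar L n (diagonal b) w` is Haar — ★ U5 p844390's binders `hμ₂ hμ₁` at U1).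

## References
* [Rogawski1990] J. D. Rogawski, *Automorphic Representations of Unitary Groups in Three Variables*, Ann. of Math. Stud. 123 (1990), §1.7 p. 6 (`dg = |Ω|_v`).
* [Knapp2002] A. W. Knapp, *Lie Groups Beyond an Introduction*, 2nd ed. (2002), I §1 (classical real forms), VIII §2 (Haar measure in coordinates).
* [Macdonald1980] I. G. Macdonald, *The volume of a compact Lie group*, Invent. Math. 56 (1980), 93–95 (the trace-form normalisation).
-/

set_option autoImplicit false
-- the scoped operator-norm structure on `M_N(ℂ)` vs the `[BorelSpace ↥(skewC …)]` binder's subtype topology (as in ★ U1 FILE B)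
set_option backward.isDefEq.respectTransparency false

noncomputable section

open MeasureTheory MeasureTheory.Measure NumberField NumberField.InfinitePlace
open scoped Classical Matrix Matrix.Norms.Operator MatrixGroups ComplexConjugate

namespace Literature.NumberTheory.Weil1964

namespace UnitaryArchLocalTopForm

open Literature.NumberTheory.Automorphic Literature.NumberTheory.Automorphic.UnitaryGroup

/-! ## §1 The skew-adjoint test element and non-degeneracy -/

section Local

variable {N : ℕ} {Jw : Matrix (Fin N) (Fin N) ℂ}

/-- For `X ∈ 𝔲(Jw)` (`Jw` hermitian, `det Jw` a unit): `Y = Xᴴ − Jw⁻¹ X Jw ∈ 𝔲(Jw)`. [cite: Knapp2002, I §1] -/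
theorem skewAdjointC_mem_skewC (hJ : Jwᴴ = Jw) (hdet : IsUnit Jw.det) {X : Matrix (Fin N) (Fin N) ℂ} (hX : X ∈ skewC N Jw) :
    Xᴴ - Jw⁻¹ * X * Jw ∈ skewC N Jw := by
  rw [mem_skewC_iff] at hX ⊢
  have hinv : Jw⁻¹ * Jw = 1 := Matrix.nonsing_inv_mul _ hdet
  have hinv' : Jw * Jw⁻¹ = 1 := Matrix.mul_nonsing_inv _ hdet
  have hJinvH : (Jw⁻¹)ᴴ = Jw⁻¹ := by rw [Matrix.conjTranspose_nonsing_inv, hJ]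
  -- `Xᴴ = -(Jw X Jw⁻¹)`
  have hXH : Xᴴ = -(Jw * X * Jw⁻¹) := by
    have := congrArg (fun A => A * Jw⁻¹) hX
    simp only [add_mul, zero_mul] at this
    rw [Matrix.mul_assoc Xᴴ, hinv', Matrix.mul_one] at this
    rw [eq_neg_iff_add_eq_zero]; exact this
  rw [Matrix.conjTranspose_sub, Matrix.conjTranspose_conjTranspose, Matrix.conjTranspose_mul, Matrix.conjTranspose_mul, hJ, hJinvH, hXH]
  simp only [Matrix.neg_mul, Matrix.mul_neg, Matrix.sub_mul, Matrix.mul_sub, Matrix.mul_assoc, hinv, Matrix.mul_one]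
  rw [← Matrix.mul_assoc Jw Jw⁻¹, hinv', Matrix.one_mul]
  abel

/-- The trace form is symmetric: `Re tr(XY) = Re tr(YX)`. [cite: Macdonald1980, p. 93] -/
theorem traceFormC_comm (X Y : Matrix (Fin N) (Fin N) ℂ) : traceFormC N X Y = traceFormC N Y X := by
  rw [traceFormC_apply, traceFormC_apply, Matrix.trace_mul_comm]

/-- **`β(X, Xᴴ − Jw⁻¹ X Jw) = 2 ∑_{ij} ‖X_{ij}‖²`** for `X ∈ 𝔲(Jw)`. [cite: Macdonald1980, p. 93] [cite: Knapp2002, I §1] -/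
theorem traceFormC_skewAdjointC_eq (hdet : IsUnit Jw.det) {X : Matrix (Fin N) (Fin N) ℂ} (hX : X ∈ skewC N Jw) :
    traceFormC N X (Xᴴ - Jw⁻¹ * X * Jw) = 2 * ∑ i, ∑ j, ‖X i j‖ ^ 2 := by
  rw [mem_skewC_iff] at hX
  have hinv' : Jw * Jw⁻¹ = 1 := Matrix.mul_nonsing_inv _ hdet
  -- `Jw X Jw⁻¹ = -Xᴴ`
  have hXH : Jw * X * Jw⁻¹ = -Xᴴ := by
    have := congrArg (fun A => A * Jw⁻¹) hX
    simp only [add_mul, zero_mul] at this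
    rw [Matrix.mul_assoc Xᴴ, hinv', Matrix.mul_one] at this
    rw [eq_neg_iff_add_eq_zero, add_comm]; exact this
  rw [traceFormC_apply, Matrix.mul_sub, Matrix.trace_sub]
  -- cyclicity: `tr(X (Jw⁻¹ X Jw)) = tr(Jw X Jw⁻¹ X) = -tr(Xᴴ X)`
  have hcyc : Matrix.trace (X * (Jw⁻¹ * X * Jw)) = Matrix.trace (Jw * X * Jw⁻¹ * X) := by
    rw [show X * (Jw⁻¹ * X * Jw) = (X * Jw⁻¹ * X) * Jw by simp only [Matrix.mul_assoc], Matrix.trace_mul_comm,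
      show Jw * (X * Jw⁻¹ * X) = Jw * X * Jw⁻¹ * X by simp only [Matrix.mul_assoc]]
  rw [hcyc, hXH, Matrix.neg_mul, Matrix.trace_neg, sub_neg_eq_add, Matrix.trace_mul_comm Xᴴ]
  -- `tr(X Xᴴ) = ∑ ‖X_ij‖²`, a real number
  have htr : Matrix.trace (X * Xᴴ) = ((∑ i, ∑ j, ‖X i j‖ ^ 2 : ℝ) : ℂ) := by
    simp only [Matrix.trace, Matrix.diag_apply, Matrix.mul_apply, Matrix.conjTranspose_apply, Complex.star_def, Complex.mul_conj,
      Complex.normSq_eq_norm_sq, Complex.ofReal_sum, Complex.ofReal_pow]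
  rw [htr, ← two_mul, ← Complex.ofReal_ofNat, ← Complex.ofReal_mul, Complex.ofReal_re]

/-- **Positivity**: `0 < β(X, Xᴴ − Jw⁻¹ X Jw)` for `X ∈ 𝔲(Jw)`, `X ≠ 0`. [cite: Macdonald1980, p. 93] [cite: Knapp2002, I §1] -/
theorem traceFormC_skewAdjointC_pos (hdet : IsUnit Jw.det) {X : Matrix (Fin N) (Fin N) ℂ} (hX : X ∈ skewC N Jw) (hX0 : X ≠ 0) :
    0 < traceFormC N X (Xᴴ - Jw⁻¹ * X * Jw) := by
  rw [traceFormC_skewAdjointC_eq hdet hX]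
  refine mul_pos two_pos ?_
  obtain ⟨i, j, hne⟩ : ∃ i j : Fin N, X i j ≠ 0 := by
    by_contra hall
    push Not at hall
    exact hX0 (Matrix.ext fun i j => by rw [hall i j, Matrix.zero_apply])
  have hle : ‖X i j‖ ^ 2 ≤ ∑ i, ∑ j, ‖X i j‖ ^ 2 := by
    refine le_trans ?_ (Finset.single_le_sum (f := fun i => ∑ j, ‖X i j‖ ^ 2) (fun i _ => Finset.sum_nonneg fun j _ => sq_nonneg _) (Finset.mem_univ i))
    exact Finset.single_le_sum (f := fun j => ‖X i j‖ ^ 2) (fun j _ => sq_nonneg _) (Finset.mem_univ j)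
  exact lt_of_lt_of_le (pow_pos (norm_pos_iff.2 hne) 2) hle

/-- **THE TRACE FORM IS NON-DEGENERATE ON `𝔲(Jw)`** (`Jw` hermitian, `det Jw` a unit): `β(X, Y) = 0` for all `Y ∈ 𝔲(Jw)` forces `X = 0`.
[cite: Macdonald1980, p. 93] [cite: Knapp2002, I §1] -/
theorem traceFormC_nondegenerate (hJ : Jwᴴ = Jw) (hdet : IsUnit Jw.det) {X : skewC N Jw}
    (h : ∀ Y : skewC N Jw, traceFormC N (X : Matrix (Fin N) (Fin N) ℂ) (Y : Matrix (Fin N) (Fin N) ℂ) = 0) : X = 0 := by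
  by_contra hX0
  have hX0' : (X : Matrix (Fin N) (Fin N) ℂ) ≠ 0 := fun h0 => hX0 (Subtype.ext h0)
  have hpos := traceFormC_skewAdjointC_pos hdet X.2 hX0'
  rw [h ⟨_, skewAdjointC_mem_skewC hJ hdet X.2⟩] at hpos
  exact lt_irrefl _ hpos

/-- **`lieGramDetC N Jw ≠ 0`** for `Jw` hermitian with `det Jw` a unit — the hypothesis `hnd` of ★ `isHaarMeasure_localTopFormHaar` ∕ ★ `localTopFormHaar_image_window` discharged: the Gram
matrix of a non-degenerate form on a basis is invertible. [cite: Macdonald1980, p. 93] [cite: Knapp2002, VIII §2] -/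
theorem lieGramDetC_ne_zero_of_conjTranspose_eq (hJ : Jwᴴ = Jw) (hdet : IsUnit Jw.det) : lieGramDetC N Jw ≠ 0 := by
  intro hzero
  set B := lieFinBasisC N Jw with hB
  obtain ⟨v, hv0, hv⟩ := (Matrix.exists_mulVec_eq_zero_iff (M := lieGramC B)).2 hzero
  -- `X := ∑ v i • B i` is non-zero and `β(B j, X) = 0` for every `j`
  set X : skewC N Jw := ∑ i, v i • B i with hXdef
  have hX0 : X ≠ 0 := by
    intro h0
    apply hv0
    have hli := B.linearIndependent
    rw [Fintype.linearIndependent_iff] at hli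
    exact funext fun i => hli v h0 i
  have hcoe : (X : Matrix (Fin N) (Fin N) ℂ) = ∑ i, v i • (B i : Matrix (Fin N) (Fin N) ℂ) := by
    rw [hXdef, Submodule.coe_sum]; rfl
  have hBX : ∀ j, traceFormC N (B j : Matrix (Fin N) (Fin N) ℂ) (X : Matrix (Fin N) (Fin N) ℂ) = 0 := by
    intro j
    have hj := congrFun hv j
    rw [Pi.zero_apply, Matrix.mulVec, dotProduct] at hj
    rw [hcoe, _root_.map_sum]
    simpa only [map_smul, smul_eq_mul, lieGramC_apply, mul_comm (v _)] using hj
  -- hence `β(X, Y) = 0` for every `Y ∈ 𝔲(Jw)` (expand `Y` in the basis; symmetry), so `X = 0`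
  refine hX0 (traceFormC_nondegenerate hJ hdet fun Y => ?_)
  have hY : (Y : Matrix (Fin N) (Fin N) ℂ) = ∑ j, B.repr Y j • (B j : Matrix (Fin N) (Fin N) ℂ) := by
    conv_lhs => rw [← B.sum_repr Y]
    rw [Submodule.coe_sum]; rfl
  rw [traceFormC_comm, hY, _root_.map_sum, LinearMap.sum_apply]
  refine Finset.sum_eq_zero fun j _ => ?_
  rw [LinearMap.map_smul, LinearMap.smul_apply, hBX j, smul_zero]

/-- **`localTopFormHaar N Jw` IS A HAAR MEASURE** for `Jw` hermitian with `det Jw` a unit — no hypothesis left. [cite: Rogawski1990, §1.7 p. 6] [cite: Knapp2002, VIII §2] -/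
theorem isHaarMeasure_localTopFormHaar_of_conjTranspose_eq [MeasurableSpace (GL (Fin N) ℂ)] [BorelSpace (GL (Fin N) ℂ)]
    (hJ : Jwᴴ = Jw) (hdet : IsUnit Jw.det) : (localTopFormHaar N Jw).IsHaarMeasure :=
  isHaarMeasure_localTopFormHaar (lieGramDetC_ne_zero_of_conjTranspose_eq hJ hdet)

end Local

/-! ## §2 CM readings: `archLocalTopFormHaar` is Haar at hermitian non-degenerate `H`, in particular at real non-zero diagonal blocks -/

section CM

variable (L : Type) [Field L] [NumberField L] [IsCMField L] (n : ℕ) (w : {w : InfinitePlace L // IsComplex w})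
  [MeasurableSpace (GL (Fin n) ℂ)] [BorelSpace (GL (Fin n) ℂ)]

omit [NumberField L] [IsCMField L] in
/-- `archLocalTopFormHaar L n H w` is a Haar measure as soon as `σ_w H` is hermitian with non-zero determinant. [cite: Rogawski1990, §1.7 p. 6] [cite: Knapp2002, VIII §2] -/
theorem isHaarMeasure_archLocalTopFormHaar_of_isHermitian (H : Matrix (Fin n) (Fin n) L)
    (hJ : (H.map w.1.embedding).IsHermitian) (hdet : (H.map w.1.embedding).det ≠ 0) : (archLocalTopFormHaar L n H w).IsHaarMeasure :=
  isHaarMeasure_archLocalTopFormHaar L n H w (lieGramDetC_ne_zero_of_conjTranspose_eq hJ (isUnit_iff_ne_zero.2 hdet))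

/-- **THE BLOCKS OF THE (U) ROAD ARE HAAR**: for a real non-zero diagonal `b : Fin n → L`, `archLocalTopFormHaar L n (diagonal b) w` is a Haar measure on `U(σ_w diag b)(ℂ)`
(★ U5 p844390's binders `hμ₂`, `hμ₁` at U1: `fun b w hb hbr => isHaarMeasure_archLocalTopFormHaar_diagonal L n w b hb hbr`). [cite: Rogawski1990, §1.7 p. 6] [cite: Knapp2002, I §1] -/
theorem isHaarMeasure_archLocalTopFormHaar_diagonal (b : Fin n → L) (hb : ∀ i, b i ≠ 0) (hbr : ∀ i, (IsCMField.complexConj L (b i) : L) = b i) :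
    (archLocalTopFormHaar L n (Matrix.diagonal b) w).IsHaarMeasure := by
  obtain ⟨hJ, hdet⟩ := isHermitian_and_det_ne_zero_diagonal_map_embedding L w b hb (fun i => UnitaryGroup.im_embedding_eq_zero_of_complexConj_eq L w (hbr i))
  exact isHaarMeasure_archLocalTopFormHaar_of_isHermitian L n w (Matrix.diagonal b) hJ hdet

end CM

end UnitaryArchLocalTopForm

end Literature.NumberTheory.Weil1964

end
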